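import Summits.AtomisticToContinuum.Crystallization.Theorems.FrustratedLawDichotomyStrainedPatchHomForceSum

/-!
# (C′) FORCE/EXEMPT PRUNE, part 4: the KERNEL-EVALUABLE (nested-sum) form of the leaf and the Finding-A MustPass in the kernel
# (27623 strained-patch piece, hcp half; decomp-a2c hand-2 g27)

MEASURED (part 2 docstring): `decide +kernel` cannot evaluate the `Fintype.piFinset` form of the 2 × 12167-label box sum («excessive memory»),
but it DOES evaluate the same sum written as three NESTED sums over `icc11` with labels `![i, j, k]` (probe: one family, half-width 2⁻¹³, 70 s).
This module gives that form and proves it equal to part 2's: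

* §1 `sum_box11_eq_nested` — `∑ bb ∈ box11, f bb = ∑ i ∈ icc11, ∑ j ∈ icc11, ∑ k ∈ icc11, f ![i, j, k]` (bijection with `icc11 ×ˢ icc11 ×ˢ icc11`),
  `forall_box11_iff_nested`;
* §2 the leaf IN PARTS: `sumA` / `sumB` (nested per-family sums), `okA` / `okB` (guards), `boxSlopeHi_eq_add`, `boxOK_of_parts`, and
  ★★ `forceOut_sound_of_parts` — the `hver` prune disjunct from `dirOK`, the two guards, integer bounds `sumA ≤ GA`, `sumB ≤ GB` and
  `slopeTestOK (GA + GB)`: five closed facts that `decide +kernel` settles one at a time (the Finding-A pilot shard is the sequel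
  `…HomForceNestPilot`, kept out of this file so that its kernel minutes never block the library build).

Definitions computable; 0 sorry; axioms standard; no instances / notation.  `--supports stmt-AtomisticToContinuum-27623`.
-/

namespace Summit.AtomisticToContinuum.Crystallization.Theorems.FrustratedLawDichotomyStrainedPatchHomForceNest

open scoped BigOperators RealInnerProductSpace
open Literature.Analysis.ValidatedNumerics.Numerics
open Summit.AtomisticToContinuum.Crystallization.Theorems.ChargedEnergyGapNegative (E3)
open Summit.AtomisticToContinuum.Crystallization.Theorems.FrustratedLawDichotomyAveragingRuleTightFree (TightNearCap BadNearCap)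
open Summit.AtomisticToContinuum.Crystallization.Theorems.FrustratedLawDichotomyExemptAbsorption (ExemptNear)
open Summit.AtomisticToContinuum.Crystallization.Theorems.FrustratedLawDichotomyStrainedPatchHomSplit
open Summit.AtomisticToContinuum.Crystallization.Theorems.FrustratedLawDichotomyStrainedPatchHomEntryGram (entryFI)
open Summit.AtomisticToContinuum.Crystallization.Theorems.FrustratedLawDichotomyStrainedPatchHomEntryGramHcp (shufFI)
open Summit.AtomisticToContinuum.Crystallization.Theorems.FrustratedLawDichotomyStrainedPatchHomForceKit
open Summit.AtomisticToContinuum.Crystallization.Theorems.FrustratedLawDichotomyStrainedPatchHomForceSum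
open Summit.AtomisticToContinuum.Crystallization.Theorems.FrustratedLawDichotomyStrainedPatchHomExemptMove (exemptNear_of_boxSlope)

/-! ## §1. `box11` sums as nested sums -/

/-- `![b 0, b 1, b 2] = b`. [formal bookkeeping] -/
theorem vec3_eta (b : Fin 3 → ℤ) : (![b 0, b 1, b 2] : Fin 3 → ℤ) = b := by
  ext i; fin_cases i <;> rfl

set_option maxRecDepth 8000 in
/-- ★ A sum over `box11 = icc11³` is the nested triple sum over `icc11` with labels `![i, j, k]`. [folklore] -/
theorem sum_box11_eq_nested (f : (Fin 3 → ℤ) → ℤ) :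
    ∑ bb ∈ box11, f bb = ∑ i ∈ icc11, ∑ j ∈ icc11, ∑ k ∈ icc11, f ![i, j, k] := by
  rw [← Finset.sum_product', ← Finset.sum_product']
  symm
  refine Finset.sum_nbij' (fun p => ![p.1.1, p.1.2, p.2]) (fun b => ((b 0, b 1), b 2)) ?_ ?_ ?_ ?_ ?_
  · intro p hp
    simp only [Finset.mem_product] at hp
    simp only [box11, Fintype.mem_piFinset]
    intro i; fin_cases i
    · exact hp.1.1
    · exact hp.1.2
    · exact hp.2
  · intro b hb
    simp only [box11, Fintype.mem_piFinset] at hb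
    simp only [Finset.mem_product]
    exact ⟨⟨hb 0, hb 1⟩, hb 2⟩
  · intro p _; rfl
  · intro b _; exact vec3_eta b
  · intro p _; rfl

/-- ★ A bounded `∀` over `box11` is the nested triple `∀` over `icc11`. [folklore] -/
theorem forall_box11_iff_nested (P : (Fin 3 → ℤ) → Prop) :
    (∀ bb ∈ box11, P bb) ↔ ∀ i ∈ icc11, ∀ j ∈ icc11, ∀ k ∈ icc11, P ![i, j, k] := by
  constructor
  · intro h i hi j hj k hk
    refine h _ ?_
    simp only [box11, Fintype.mem_piFinset]
    intro a; fin_cases a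
    · exact hi
    · exact hj
    · exact hk
  · intro h bb hbb
    simp only [box11, Fintype.mem_piFinset] at hbb
    have := h (bb 0) (hbb 0) (bb 1) (hbb 1) (bb 2) (hbb 2)
    rwa [vec3_eta] at this

/-! ## §2. The leaf IN PARTS: per-family nested sums and guards, each a separately kernel-decidable fact -/

/-- `A`-family nested sum of the per-label bounds (zero label skipped). -/
def sumA (en : Fin 3 → ℤ) (ed : ℕ) (sn : ℤ) (sd : ℕ) (E : Fin 3 × Fin 3 → FI) : ℤ :=
  ∑ i ∈ icc11, ∑ j ∈ icc11, ∑ k ∈ icc11, termVal en ed sn sd (decide ((![i, j, k] : Fin 3 → ℤ) = 0)) (vecA E ![i, j, k])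

/-- `B`-family nested sum of the per-label bounds. -/
def sumB (en : Fin 3 → ℤ) (ed : ℕ) (sn : ℤ) (sd : ℕ) (E : Fin 3 × Fin 3 → FI) (X : Fin 3 → FI) : ℤ :=
  ∑ i ∈ icc11, ∑ j ∈ icc11, ∑ k ∈ icc11, termVal en ed sn sd false (vecB E X ![i, j, k])

/-- `A`-family guard (every label enclosed). -/
def okA (en : Fin 3 → ℤ) (ed : ℕ) (sn : ℤ) (sd : ℕ) (E : Fin 3 × Fin 3 → FI) : Bool :=
  decide (∀ i ∈ icc11, ∀ j ∈ icc11, ∀ k ∈ icc11, termOK en ed sn sd (decide ((![i, j, k] : Fin 3 → ℤ) = 0)) (vecA E ![i, j, k]) = true)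

/-- `B`-family guard. -/
def okB (en : Fin 3 → ℤ) (ed : ℕ) (sn : ℤ) (sd : ℕ) (E : Fin 3 × Fin 3 → FI) (X : Fin 3 → FI) : Bool :=
  decide (∀ i ∈ icc11, ∀ j ∈ icc11, ∀ k ∈ icc11, termOK en ed sn sd false (vecB E X ![i, j, k]) = true)

/-- `boxSlopeHi = sumA + sumB`. [formal bookkeeping] -/
theorem boxSlopeHi_eq_add (en : Fin 3 → ℤ) (ed : ℕ) (sn : ℤ) (sd : ℕ) (E : Fin 3 × Fin 3 → FI) (X : Fin 3 → FI) :
    boxSlopeHi en ed sn sd E X = sumA en ed sn sd E + sumB en ed sn sd E X := by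
  unfold boxSlopeHi sumA sumB
  rw [sum_box11_eq_nested, sum_box11_eq_nested]

/-- The two family guards give `boxOK`. [formal bookkeeping] -/
theorem boxOK_of_parts {en : Fin 3 → ℤ} {ed : ℕ} {sn : ℤ} {sd : ℕ} {E : Fin 3 × Fin 3 → FI} {X : Fin 3 → FI}
    (hA : okA en ed sn sd E = true) (hB : okB en ed sn sd E X = true) : boxOK en ed sn sd E X = true := by
  simp only [okA, okB, decide_eq_true_eq] at hA hB
  simp only [boxOK, decide_eq_true_eq]
  rw [forall_box11_iff_nested (fun bb => termOK en ed sn sd (decide (bb = 0)) (vecA E bb) = true ∧ termOK en ed sn sd false (vecB E X bb) = true)]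
  exact fun i hi j hj k hk => ⟨hA i hi j hj k hk, hB i hi j hj k hk⟩

/-- ★★ **SOUNDNESS FROM PARTS**: direction at most unit, both family guards, integer bounds `sumA ≤ GA`, `sumB ≤ GB` and the threshold test on
`GA + GB` give the `hver` prune disjunct for every `(U, ξ)` of the box — each hypothesis is a closed Boolean/integer fact that `decide +kernel` settles
SEPARATELY (the single-term form of part 2 exceeds the kernel's memory). [folklore] -/
theorem forceOut_sound_of_parts {en : Fin 3 → ℤ} {ed : ℕ} {sn : ℤ} {sd : ℕ} {c w : (Fin 3 × Fin 3) ⊕ Fin 3 → ℤ} {GA GB : ℤ}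
    (hdir : dirOK en ed = true) (hsd : 0 < sd)
    (hokA : okA en ed sn sd (entryFI (fun ab => c (Sum.inl ab)) (fun ab => w (Sum.inl ab))) = true)
    (hokB : okB en ed sn sd (entryFI (fun ab => c (Sum.inl ab)) (fun ab => w (Sum.inl ab))) (shufFI c w) = true)
    (hA : sumA en ed sn sd (entryFI (fun ab => c (Sum.inl ab)) (fun ab => w (Sum.inl ab))) ≤ GA)
    (hB : sumB en ed sn sd (entryFI (fun ab => c (Sum.inl ab)) (fun ab => w (Sum.inl ab))) (shufFI c w) ≤ GB)
    (htest : slopeTestOK (GA + GB) sn sd = true)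
    (U : E3 →L[ℝ] E3) (ξ : E3) (hU : ‖U - 1‖ ≤ 1 / 4) (hξn : ‖ξ‖ ≤ 1 / 4)
    (hbox : ∀ ab : Fin 3 × Fin 3, |(U (EuclideanSpace.single ab.2 (1 : ℝ))) ab.1 - (c (Sum.inl ab) : ℝ) / SC| ≤ (w (Sum.inl ab) : ℝ) / SC)
    (hξ : ∀ i : Fin 3, |ξ i - (c (Sum.inr i) : ℝ) / SC| ≤ (w (Sum.inr i) : ℝ) / SC) :
    ∀ (M : ℕ) (z : Fin M → E3) (cc : Fin M), Function.Injective z →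
      Set.range z = {x : E3 | dist x (z cc) ≤ 133 / 10 ∧ ∃ a : Fin 3 → ℤ,
        x = z cc + latPt U hexFrame a ∨ x = z cc + latPt U hexFrame a + U (hcpShift + ξ)} →
      TightNearCap (9 / 5) (3 / 2) z cc ∨ ExemptNear (9 / 5) ExRec z cc ∨ BadNearCap (9 / 5) (3 / 2) z cc := by
  intro M z cc hz hrange
  obtain ⟨hed, he⟩ := norm_dirVec_le_one hdir
  obtain ⟨hs0, hs38, hG⟩ := lt_threshold_of_slopeTestOK hsd htest
  have hS := SC_pos
  have hok := boxOK_of_parts hokA hokB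
  have hGsum : (boxSlopeHi en ed sn sd (entryFI (fun ab => c (Sum.inl ab)) (fun ab => w (Sum.inl ab))) (shufFI c w) : ℝ) ≤ ((GA + GB : ℤ) : ℝ) := by
    rw [boxSlopeHi_eq_add]; exact_mod_cast add_le_add hA hB
  refine Or.inr (Or.inl (exemptNear_of_boxSlope hz hU hξn hrange (dirVec en ed) he (s := (sn : ℝ) / sd) (b := -(((GA + GB : ℤ) : ℝ) / SC))
    hs0 hs38 (fun τ hτ => ?_) ?_))
  · have hle := boxSlope_le U ξ hU hξn hbox hξ hed hsd hok hτ.1 hτ.2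
    have e : ∀ (v : E3), (if v ≠ 0 ∧ ‖v‖ ≤ 7 then
        ((‖τ • dirVec en ed - v‖⁻¹) ^ 8 - (‖τ • dirVec en ed - v‖⁻¹) ^ 14) * ⟪τ • dirVec en ed - v, dirVec en ed⟫ else 0) =
        cutSlope v (dirVec en ed) τ := fun v => rfl
    simp only [e]
    rw [neg_neg, le_div_iff₀ hS]
    exact hle.trans hGsum
  · have hs0' : (0 : ℝ) < (sn : ℝ) / sd := hs0
    nlinarith [hG, hs0']

end Summit.AtomisticToContinuum.Crystallization.Theorems.FrustratedLawDichotomyStrainedPatchHomForceNest
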